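import Summits.ResolutionOfSingularities.ResolutionOfSingularities.Theorems.EquisingularLiftEquisingularLiftNatTowerCechRoundThree
import Summits.ResolutionOfSingularities.ResolutionOfSingularities.Theorems.EquisingularLiftEquisingularLiftNatTowerCechRoundOldThree
import HarnessLib

/-!
# [OURS · L1 W4.5(b) · EL♮(3) NINETEENTH plumbing `stub_elnat_defTowerPointResolution`] HSUB′(ReachTower₅) — THE EMBEDDED-LIFT ROUND
# (`TowerRound₄`'s Čech rounds, section OR rational multisection) on `Tower.Inv₃` at a GENERIC exceptional-surface datum `Ruled`

Cell `res-hironaka`, LADDER-RESOLUTION rung L (D-0089), slot W4.5(b), crux chain w45b: working crux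
`Theses.EquisingularLift.EquisingularLiftNat` (stmt-ResolutionOfSingularities-20038) / child `EquisingularLiftNatThree`
(stmt-ResolutionOfSingularities-20148); NINETEENTH registration (res-L1-w45b-lead-2, CHILD v25 57d7b692b3b7f90b): the PLUMBING rung
`stub_elnat_defTowerPointResolution (p) : EmbeddedCurveLiftFact → <CONETOWER rung with ReachTower₅>` (owner res-L1-w45b-stub-4 g9), carved
brick «the round case» dealt BY SIGNATURE to res-L1-w45b-stub-2 g9 (desk STATUS l.78112; stub-4's sig `L/res-L1-w45b-stub-4/ROUND4-emb.sig.lean`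
a63a201c4f329aee). `--supports stmt-ResolutionOfSingularities-20148 --as helper`. OURS; NOT a statement of any manuscript; AI-written, and AI
review is weaker than expert review. No `sorry`, standard axioms, DEF-FREE.

WHAT. `Tower.inv₃_embRound_new` / `Tower.inv₃_embRound_old` = res-L1-w45b-stub-4's `Tower.inv₃_cechRound_new` (…NatTowerCechRoundThree) /
`Tower.inv₃_cechRound_old_kiv` (…NatTowerCechRoundOldThree) with: (i) `(Ruled : Tower.RuledDatum P)` GENERIC (in `hinv`, in `hCentre`'s last binder,
in the conclusion) — the engine instantiates `Ruled := fun … X σ jG 𝓔 => Flat (𝓔.subschemeι ≫ σ ≫ q)`; (ii) `hsec : DirStepSec …` DELETED (rational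
MULTISECTIONS of any degree are admitted: the centre now comes from the NEED-FACT (T-k) `EmbeddedCurveLiftAt`, handed in through `hCentre`);
(iii) `hCentre`'s clause (c6) «`RationalCarrier Z̃₉ → V(𝒞) ≅ ℙ¹_O`» DELETED (no ruled-surface datum is born from a section any more); (iv) ONE NEW
hypothesis `hRuled` — BIRTH of the datum for the new surface `𝒞·𝒪_{X″}` (shape of `Tower.inv₃_coneRound_new`'s `hRuled`, `𝒦 ↦ 𝒦₁`) / TRANSPORT
along `V(St 𝓔) ≅ V(𝓔)` for the old surface (shape of `Tower.inv₃_coneRound_old`'s `hRuled`). `_new` is the sig VERBATIM. `_old` is the sig with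
ONE CORRECTION (stub-misstated, STATUS ≈01:57Z): its (N3′) stand-in `hShadowOld` carries the old pair's (k-iv) clause (the `_kiv` binder of
`Tower.inv₃_cechRound_old_kiv` / the TYPE of the discharge `Tower.hShadowOld_of` p583769) — without it the stand-in is not dischargeable
(res-L1-w45b-stub-2 g8 FINDING 2026-08-27T21:54:54Z: `𝓔 = (e)`, `𝒦 = (xy − ϖ²)` in `𝔸³_O`). Proofs: the ₃ proofs verbatim with `he5`/`ho5` :=
`hRuled …`.
References (index only): [cite: GortzWedhorn2020] (13.19), Prop. 13.91; [cite: Liu2002] Thm. 8.1.19; [cite: Matsumura1987] §16.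
-/

set_option linter.dupNamespace false -- mandated namespace `Summit.<Summit>.<Problem>` of this single-conjunct summit

noncomputable section

open CategoryTheory CategoryTheory.Limits AlgebraicGeometry TopologicalSpace Topology IsLocalRing
open Literature.AlgebraicGeometry.Resolution
open Literature.AlgebraicGeometry.Morphisms (ProjCech.PP ProjCech.toSpec)
open AlgebraicGeometry.Scheme.IdealSheafData
open Summit.ResolutionOfSingularities.ResolutionOfSingularities.Theses.EquisingularLift.Split
open Summit.ResolutionOfSingularities.ResolutionOfSingularities.Cruxes.EquisingularLift.StrataSplit

namespace Summit.ResolutionOfSingularities.ResolutionOfSingularities.Cruxes.EquisingularLiftNat.Sections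

set_option maxHeartbeats 800000 in -- one large refine over a 20-clause invariant (as in the ₃ files)
/-- **THE EMBEDDED-LIFT ROUND on `Tower.Inv₃` at a generic exceptional-surface datum, NEW exceptional surface** (stub-4's signature VERBATIM):
the Čech round of `TowerRound₄` (section or rational multisection — no `DirStepSec`), centre `𝒞 = 𝓔 ⊔ 𝒦₁` handed in by `hCentre` (engine: (T-k)
`EmbeddedCurveLiftAt`), the datum of the new surface `𝒞·𝒪_{X″}` BORN by `hRuled`, the shadow transported by the (N3) stand-in `hShadow`
(discharged by `Tower.hShadow_of`). [cite: GortzWedhorn2020, (13.19) and Prop. 13.91] [cite: Liu2002, Thm. 8.1.19] [OURS · L1 W4.5b] clause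
(round) of the tower driver toward `stub_elnat_defTowerPointResolution`; NOT a statement of the manuscript. -/
theorem Tower.inv₃_embRound_new (O : Type) [CommRing O] [IsDomain O] [IsDiscreteValuationRing O] (k : Type) [Field k]
    (θ : O →+* k) (hθ : Function.Surjective θ)
    (P : Scheme.{0}) (q : P ⟶ Spec (.of O)) [IsProper q] (Y : Set P) (hYirr : IsIrreducible Y) (hYcl : IsClosed Y)
    (hPnoeth : IsLocallyNoetherian P) (hPreg : Scheme.IsRegular P)
    (Ch : ∀ X' : Scheme.{0}, (X' ⟶ P) → Set X' → Prop)
    (hChain : ∀ (X' : Scheme.{0}) (σ : X' ⟶ P) (S : Set X'), Ch X' σ S → Chain P Y X' σ S)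
    (hStep : ∀ (X' X'' : Scheme.{0}) (σ' : X' ⟶ P) (S' : Set X') (C : X'.IdealSheafData) (τ : X'' ⟶ X'),
      Ch X' σ' S' → IsBlowup τ C → Scheme.IsRegular C.subscheme → Flat (C.subschemeι ≫ σ' ≫ q) →
      σ' '' (C.support : Set X') ⊆ {x : P | ¬ IsGenericPoint x Y} →
      (C.support : Set X') ∩ (σ' ≫ q) ⁻¹' {IsLocalRing.closedPoint O} ⊆ S' →
      Ch X'' (τ ≫ σ') (closure (τ ⁻¹' (S' \ (C.support : Set X')))))
    (Ruled : Tower.RuledDatum P)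
    {F₉ : Scheme.{0}} (Z₉ : Set F₉) (hZ₉ : IsClosed Z₉) {F₁₀ : Scheme.{0}} (υ' : F₁₀ ⟶ F₉)
    (G G' : Scheme.{0}) (γ : G ⟶ F₁₀) (T E K : Set G) (hE : IsClosed E) (Z : Set G) (hZ : IsClosed Z) (υ₂ : G' ⟶ G)
    (hinv : Tower.Inv₃ O k θ P q Y Ch Ruled F₉ Z₉ hZ₉ F₁₀ υ' G γ T E K)
    (hZET : Z ⊆ E ∩ T) (hfull : TowerFull F₉ F₁₀ υ' Z₉ hZ₉ G γ Z hZ)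
    (hυ₂ : IsBlowup υ₂ (vanishingIdeal ⟨Z, hZ⟩))
    -- the assembly's downstairs side facts carried next to `Tower.Inv₂`
    (hKcl : IsClosed K) (hKE : K ⊆ closure (K \ E)) (hKne : K ≠ Set.univ)
    -- THE CENTRE `𝒞 = 𝓔 ⊔ 𝒦₁` at this stage — engine-supplied from `EmbeddedCurveLiftAt` ((T-k), `𝓔 ≤ 𝒞`), frames from `hFrame_of_ringKrullDim_redSub`;
    -- ₃'s (c6) «rational ⇒ `V(𝒞) ≅ ℙ¹_O`» DROPPED (no ruled-surface datum is born from a section any more)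
    (hCentre : ∀ (X : Scheme.{0}) (σ : X ⟶ P) (S : Set X) (jG : G ⟶ X) (tG : G ⟶ Spec (.of k)) (𝓔 : X.IdealSheafData),
        Ch X σ S → IsIntegral X → IsLocallyNoetherian X → Scheme.IsRegular X → IsDominant (σ ≫ q) →
        IsPullback jG tG (σ ≫ q) (Spec.map (CommRingCat.ofHom θ)) → jG '' T = S →
        𝓔.comap jG = vanishingIdeal ⟨E, hE⟩ → (∀ z : X, (stalkIdeal 𝓔 z).IsPrincipal) → Scheme.IsRegular 𝓔.subscheme →
        σ '' (𝓔.support : Set X) ⊆ {p : P | ¬ IsGenericPoint p Y} →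
        Ruled F₉ Z₉ hZ₉ F₁₀ υ' G γ E X σ jG 𝓔 →
        ∃ 𝒦₁ : X.IdealSheafData,
          (𝓔 ⊔ 𝒦₁).comap jG = vanishingIdeal ⟨Z, hZ⟩ ∧ Flat ((𝓔 ⊔ 𝒦₁).subschemeι ≫ σ ≫ q) ∧
          Scheme.IsRegular (𝓔 ⊔ 𝒦₁).subscheme ∧ IsEffectiveCartier (𝒦₁.comap 𝓔.subschemeι) ∧
          (∀ x ∈ (𝓔 ⊔ 𝒦₁).support, ∃ c : Fin 2 → X.presheaf.stalk x,
            Ideal.span (Set.range c) = stalkIdeal (𝓔 ⊔ 𝒦₁) x ∧ IsQuasiRegular c))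
    -- (N3) STAND-IN: the transported shadow after a Čech round OFF the shadow (owner res-D-pv-051 / res-L1-w45b-stub-2)
    (hShadow : ∀ (X : Scheme.{0}) (σ : X ⟶ P) (S : Set X) (jG : G ⟶ X) (tG : G ⟶ Spec (.of k)) (𝓔 𝒦 𝒦₁ : X.IdealSheafData)
        (X₂ : Scheme.{0}) (τ : X₂ ⟶ X) (j₂ : G' ⟶ X₂) (t₂ : G' ⟶ Spec (.of k)),
        Ch X σ S → IsIntegral X → IsLocallyNoetherian X → Scheme.IsRegular X → IsDominant (σ ≫ q) →
        IsPullback jG tG (σ ≫ q) (Spec.map (CommRingCat.ofHom θ)) → jG '' T = S →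
        𝓔.comap jG = vanishingIdeal ⟨E, hE⟩ → (∀ z : X, (stalkIdeal 𝓔 z).IsPrincipal) → Scheme.IsRegular 𝓔.subscheme →
        (∀ z : X, (stalkIdeal 𝒦 z).IsPrincipal) → ∀ (V : G.Opens), E ⊆ (V : Set G) →
        (𝒦.comap jG).comap V.ι = (vanishingIdeal (⟨closure K, isClosed_closure⟩ : Closeds G)).comap V.ι →
        Flat ((𝓔 ⊔ 𝒦).subschemeι ≫ σ ≫ q) → IsEffectiveCartier (𝓔.comap 𝒦.subschemeι) → IsEffectiveCartier (𝒦.comap 𝓔.subschemeι) →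
        (𝓔 ⊔ 𝒦₁).comap jG = vanishingIdeal ⟨Z, hZ⟩ → Flat ((𝓔 ⊔ 𝒦₁).subschemeι ≫ σ ≫ q) → Scheme.IsRegular (𝓔 ⊔ 𝒦₁).subscheme →
        IsEffectiveCartier (𝒦₁.comap 𝓔.subschemeι) →
        IsBlowup τ (𝓔 ⊔ 𝒦₁) → IsPullback j₂ t₂ ((τ ≫ σ) ≫ q) (Spec.map (CommRingCat.ofHom θ)) → j₂ ≫ τ = υ₂ ≫ jG →
        IsClosed K → K ⊆ closure (K \ E) → K ≠ Set.univ → closure (Z \ closure K) = Z →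
        ((strictTransformIdeal τ (𝓔 ⊔ 𝒦₁) 𝒦).comap j₂).comap (υ₂ ⁻¹ᵁ V).ι =
            (vanishingIdeal (⟨closure (closure (υ₂ ⁻¹' (K \ Z))), isClosed_closure⟩ : Closeds G')).comap (υ₂ ⁻¹ᵁ V).ι ∧
          Flat ((((𝓔 ⊔ 𝒦₁).comap τ) ⊔ strictTransformIdeal τ (𝓔 ⊔ 𝒦₁) 𝒦).subschemeι ≫ (τ ≫ σ) ≫ q) ∧
          (∀ (hE' : IsClosed (υ₂ ⁻¹' Z)) (y : G'),
            j₂ y ∈ ((((𝓔 ⊔ 𝒦₁).comap τ) ⊔ strictTransformIdeal τ (𝓔 ⊔ 𝒦₁) 𝒦).support : Set X₂) →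
            stalkIdeal (vanishingIdeal (⟨υ₂ ⁻¹' Z, hE'⟩ : Closeds G') ⊔
              vanishingIdeal (⟨closure (closure (υ₂ ⁻¹' (K \ Z))), isClosed_closure⟩ : Closeds G')) y =
            stalkIdeal (vanishingIdeal (⟨υ₂ ⁻¹' Z ∩ closure (closure (υ₂ ⁻¹' (K \ Z))), hE'.inter isClosed_closure⟩ : Closeds G')) y →
            IsRegularLocalRing (X₂.presheaf.stalk (j₂ y) ⧸
              stalkIdeal (((𝓔 ⊔ 𝒦₁).comap τ) ⊔ strictTransformIdeal τ (𝓔 ⊔ 𝒦₁) 𝒦) (j₂ y))) ∧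
          IsEffectiveCartier (((𝓔 ⊔ 𝒦₁).comap τ).comap (strictTransformIdeal τ (𝓔 ⊔ 𝒦₁) 𝒦).subschemeι) ∧
          IsEffectiveCartier ((strictTransformIdeal τ (𝓔 ⊔ 𝒦₁) 𝒦).comap ((𝓔 ⊔ 𝒦₁).comap τ).subschemeι))
    -- BIRTH of the (generic) exceptional-surface datum `Ruled` for the NEW surface `𝒞·𝒪_{X''}` (engine: `Ruled := Tower.FlatExc`, born by
    -- `flat_exceptional_of_isBlowup_regularCentre`) — shape verbatim from `Tower.inv₃_coneRound_new` (…NatTowerConeRoundThree) with `𝒦 ↦ 𝒦₁`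
    (hRuled : ∀ (X : Scheme.{0}) (σ : X ⟶ P) (S : Set X) (jG : G ⟶ X) (tG : G ⟶ Spec (.of k)) (𝓔 𝒦₁ : X.IdealSheafData)
        (X'' : Scheme.{0}) (τ : X'' ⟶ X) (j₂ : G' ⟶ X'') (t₂ : G' ⟶ Spec (.of k)),
        Ch X σ S → IsIntegral X → IsLocallyNoetherian X → Scheme.IsRegular X → IsDominant (σ ≫ q) →
        IsPullback jG tG (σ ≫ q) (Spec.map (CommRingCat.ofHom θ)) → jG '' T = S →
        (𝓔 ⊔ 𝒦₁).comap jG = vanishingIdeal ⟨Z, hZ⟩ → Flat ((𝓔 ⊔ 𝒦₁).subschemeι ≫ σ ≫ q) → Scheme.IsRegular (𝓔 ⊔ 𝒦₁).subscheme →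
        Scheme.IsRegular 𝓔.subscheme → IsBlowup τ (𝓔 ⊔ 𝒦₁) → IsPullback j₂ t₂ ((τ ≫ σ) ≫ q) (Spec.map (CommRingCat.ofHom θ)) →
        j₂ ≫ τ = υ₂ ≫ jG →
        Ruled F₉ Z₉ hZ₉ F₁₀ υ' G' (υ₂ ≫ γ) (υ₂ ⁻¹' Z) X'' (τ ≫ σ) j₂ ((𝓔 ⊔ 𝒦₁).comap τ))
    (K' : Set G') (hK' : K' = ∅ ∨ (closure (Z \ closure K) = Z ∧ K' = closure (υ₂ ⁻¹' (K \ Z)))) :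
    Tower.Inv₃ O k θ P q Y Ch Ruled F₉ Z₉ hZ₉ F₁₀ υ' G' (υ₂ ≫ γ) (closure (υ₂ ⁻¹' (T \ Z))) (υ₂ ⁻¹' Z) K' := by
  classical
  obtain ⟨hυ', hZinf, hGint, hTcl, hTirr, hEcl, hTE₀, X, σ, S, jG, tG, hCh, hXint, hXnoeth, hXreg, hdom, hsq, hTS, hexc⟩ := hinv
  haveI := hGint
  haveI := hXint
  haveI := hXnoeth
  -- the exceptional surface hosts this round, so it is round-ready
  have hZE : Z ⊆ E := fun z hz => (hZET hz).1
  have hZT : Z ⊆ T := fun z hz => (hZET hz).2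
  rcases hexc hE with hno | ⟨𝓔, he_i, he_ii, he_iii, he_iv, he_v, hshadow⟩
  · exact absurd hfull (Tower.not_towerFull_of_noRound υ' Z₉ hZ₉ hZinf G γ E hno Z hZ hZE)
  -- (N1) the Čech centre `𝒞 = 𝓔 ⊔ 𝒦₁`
  obtain ⟨𝒦₁, hc1, hc2, hc3, hc4, hc5⟩ :=
    hCentre X σ S jG tG 𝓔 hCh hXint hXnoeth hXreg hdom hsq hTS he_i he_ii he_iii he_iv he_v
  -- properness of the stage; the model square
  obtain ⟨-, -, hσ⟩ := chain_isRegular P Y X σ S (hChain _ _ _ hCh) hPnoeth hPreg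
  haveI := hσ
  haveI : IsProper (σ ≫ q) := inferInstance
  haveI : IsClosedImmersion (Spec.map (CommRingCat.ofHom θ)) := IsClosedImmersion.spec_of_surjective _ hθ
  haveI hjci : IsClosedImmersion jG := MorphismProperty.IsStableUnderBaseChange.of_isPullback hsq.flip inferInstance
  -- the centre is off the generic point of `Y` (it lies on `V(𝓔)`)
  have hiv : σ '' ((𝓔 ⊔ 𝒦₁).support : Set X) ⊆ {p : P | ¬ IsGenericPoint p Y} := by
    rintro _ ⟨x, hx, rfl⟩
    exact he_iv ⟨x, Scheme.IdealSheafData.support_antitone le_sup_left hx, rfl⟩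
  -- support bookkeeping downstairs
  have hsuppZ : ((vanishingIdeal ⟨Z, hZ⟩ : G.IdealSheafData).support : Set G) = Z := Scheme.IdealSheafData.coe_support_vanishingIdeal _
  have hDT : ((vanishingIdeal ⟨Z, hZ⟩ : G.IdealSheafData).support : Set G) ⊆ T := by rw [hsuppZ]; exact hZT
  have hTZ : ¬ T ⊆ Z := fun h => hTE₀ (h.trans hZE)
  have hTD : ¬ T ⊆ ((vanishingIdeal ⟨Z, hZ⟩ : G.IdealSheafData).support : Set G) := by rw [hsuppZ]; exact hTZ
  -- blow up the centre and run the model step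
  obtain ⟨X₂, τ, hτ⟩ := exists_isBlowup X (𝓔 ⊔ 𝒦₁)
  obtain ⟨hint₂, hnoeth₂, hreg₂, hdom₂, hF₂, hirr, j₂, t₂, hsq₂, hcomm, hCh₂⟩ :=
    modelStep_chain O k θ hθ P q Y hYirr hYcl Ch hChain hStep X σ S hCh hXreg hdom G jG tG hsq T hTS (𝓔 ⊔ 𝒦₁)
      (vanishingIdeal ⟨Z, hZ⟩) hc1 hc3 hc2 hiv hDT hTD X₂ τ hτ G' υ₂ hυ₂
  rw [hsuppZ] at hirr hCh₂
  haveI := hint₂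
  haveI := hnoeth₂
  haveI := hF₂
  haveI : IsProper τ := hτ.isProper
  -- a point of `G'` off the exceptional surface, `T' ⊄ E'`, the centre is non-zero
  obtain ⟨t, htT, htE⟩ := Set.not_subset.mp hTE₀
  have htZ : t ∉ Z := fun h => htE (hZE h)
  obtain ⟨t', ht'⟩ := hυ₂.exists_preimage_of_not_mem_support (z := t) (by rw [hsuppZ]; exact htZ)
  have hTE : ¬ closure (υ₂ ⁻¹' (T \ Z)) ⊆ υ₂ ⁻¹' Z := by
    intro h
    have h1 : t' ∈ closure (υ₂ ⁻¹' (T \ Z)) := subset_closure (show υ₂ t' ∈ T \ Z by rw [ht']; exact ⟨htT, htZ⟩)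
    have h2 : υ₂ t' ∈ Z := h h1
    rw [ht'] at h2
    exact htZ h2
  have hCne : 𝓔 ⊔ 𝒦₁ ≠ ⊥ := by
    rintro hbot
    obtain ⟨u, hu, hKu⟩ := hτ.isEffectiveCartier.exists_stalkIdeal_eq_span (j₂ t')
    rw [hbot, Scheme.IdealSheafData.comap_bot, stalkIdeal_bot, eq_comm, Ideal.span_singleton_eq_bot] at hKu
    rw [hKu] at hu
    exact zero_notMem_nonZeroDivisors hu
  -- quasi-regular frames of the centre at the points over `Z` ((c5))
  have hqr : ∀ z ∈ ((⟨Z, hZ⟩ : Closeds G) : Set G), ∃ (n : ℕ) (c : Fin n → X.presheaf.stalk (jG z)),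
      Ideal.span (Set.range c) = stalkIdeal (𝓔 ⊔ 𝒦₁) (jG z) ∧ IsQuasiRegular c := by
    intro z hz
    have hzC : jG z ∈ ((𝓔 ⊔ 𝒦₁).support : Set X) := by
      have h1 : z ∈ (((𝓔 ⊔ 𝒦₁).comap jG).support : Set G) := by rw [hc1, hsuppZ]; exact hz
      rw [Scheme.IdealSheafData.support_comap] at h1
      exact h1
    obtain ⟨c, hc, hq⟩ := hc5 (jG z) hzC
    exact ⟨2, c, hc, hq⟩
  -- (e-i)…(e-iv) for the new exceptional surface `𝓔' := 𝒞·𝒪_{X₂}`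
  have he1 : ((𝓔 ⊔ 𝒦₁).comap τ).comap j₂ = vanishingIdeal ⟨υ₂ ⁻¹' Z, hZ.preimage υ₂.continuous⟩ :=
    comap_comap_eq_vanishingIdeal_preimage_of_model O k θ hθ (σ ≫ q) jG tG hsq (𝓔 ⊔ 𝒦₁) τ hτ j₂ t₂
      (by simpa only [Category.assoc] using hsq₂) υ₂ hcomm ⟨Z, hZ⟩ hc1 hqr
  have he2 : ∀ z : X₂, (stalkIdeal ((𝓔 ⊔ 𝒦₁).comap τ) z).IsPrincipal := fun z => by
    obtain ⟨u, -, hu⟩ := hτ.isEffectiveCartier.exists_stalkIdeal_eq_span z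
    exact ⟨⟨u, by rw [hu, Ideal.submodule_span_eq]⟩⟩
  have he3 : Scheme.IsRegular ((𝓔 ⊔ 𝒦₁).comap τ).subscheme := hτ.isRegular_subscheme_comap hXreg hc3
  have he4 : (τ ≫ σ) '' (((𝓔 ⊔ 𝒦₁).comap τ).support : Set X₂) ⊆ {p : P | ¬ IsGenericPoint p Y} := by
    rintro _ ⟨z, hz, rfl⟩
    rw [Scheme.IdealSheafData.support_comap] at hz
    exact hiv ⟨τ z, hz, rfl⟩
  -- (e-v) the (generic) exceptional-surface datum of the new surface is BORN here (`hRuled`)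
  have he5 : Ruled F₉ Z₉ hZ₉ F₁₀ υ' G' (υ₂ ≫ γ) (υ₂ ⁻¹' Z) X₂ (τ ≫ σ) j₂ ((𝓔 ⊔ 𝒦₁).comap τ) :=
    hRuled X σ S jG tG 𝓔 𝒦₁ X₂ τ j₂ t₂ hCh hXint hXnoeth hXreg hdom hsq hTS hc1 hc2 hc3 he_iii hτ hsq₂ hcomm
  -- (k-i) for the transported shadow is generic
  have hk1 : ∀ (𝒦 : X.IdealSheafData), (∀ z : X, (stalkIdeal 𝒦 z).IsPrincipal) →
      ∀ z : X₂, (stalkIdeal (strictTransformIdeal τ (𝓔 ⊔ 𝒦₁) 𝒦) z).IsPrincipal := fun 𝒦 h𝒦 z =>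
    isPrincipal_stalkIdeal_strictTransformIdeal hXreg hc3 hτ hCne 𝒦 h𝒦 z
  -- assemble
  refine ⟨hυ', hZinf, hF₂, isClosed_closure, hirr, hZ.preimage υ₂.continuous, hTE, X₂, τ ≫ σ, _, j₂, t₂, hCh₂, hint₂, hnoeth₂,
    hreg₂, hdom₂, hsq₂, rfl, fun hE' => Or.inr ⟨(𝓔 ⊔ 𝒦₁).comap τ, he1, he2, he3, he4, he5, ?_⟩⟩
  rcases hK' with hK' | ⟨hoff, hK'⟩
  · exact Or.inl hK'
  · subst hK'
    -- the shadow: forgotten upstairs (`K = ∅`, then `K′ = ∅`) or transported by (N3)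
    rcases hshadow with hK0 | ⟨𝒦, hk_i, ⟨V, hEV, hk_ii⟩, hk_iii, hk_iv, hk_v, hk_vi⟩
    · left
      subst hK0
      simp only [Set.empty_sdiff, Set.preimage_empty, closure_empty]
    · right
      obtain ⟨hs2, hs3, hs4, hs5, hs6⟩ := hShadow X σ S jG tG 𝓔 𝒦 𝒦₁ X₂ τ j₂ t₂ hCh hXint hXnoeth hXreg hdom hsq hTS he_i he_ii he_iii
        hk_i V hEV hk_ii hk_iii hk_v hk_vi hc1 hc2 hc3 hc4 hτ hsq₂ hcomm hKcl hKE hKne hoff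
      exact ⟨_, hk1 𝒦 hk_i, ⟨υ₂ ⁻¹ᵁ V, Set.preimage_mono (hZE.trans hEV), hs2⟩, hs3, hs4 hE', hs5, hs6⟩


set_option maxHeartbeats 800000 in -- one large refine over a 20-clause invariant (as in the ₃ files)
/-- **THE EMBEDDED-LIFT ROUND on `Tower.Inv₃` at a generic exceptional-surface datum, transported OLD exceptional surface** (stub-4's
signature with the (N3′) stand-in `hShadowOld` in its dischargeable `_kiv` form — the TYPE of `Tower.hShadowOld_of`): centre from `hCentre`,
datum of the old surface TRANSPORTED along `V(St 𝓔) ≅ V(𝓔)` by `hRuled`. [cite: GortzWedhorn2020, (13.19) and Prop. 13.91]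
[cite: Liu2002, Thm. 8.1.19] [cite: Matsumura1987, §16] [OURS · L1 W4.5b] clause (round) of the tower driver toward
`stub_elnat_defTowerPointResolution`; NOT a statement of the manuscript. -/
theorem Tower.inv₃_embRound_old (O : Type) [CommRing O] [IsDomain O] [IsDiscreteValuationRing O] (k : Type) [Field k]
    (θ : O →+* k) (hθ : Function.Surjective θ)
    (P : Scheme.{0}) (q : P ⟶ Spec (.of O)) [IsProper q] (Y : Set P) (hYirr : IsIrreducible Y) (hYcl : IsClosed Y)
    (hPnoeth : IsLocallyNoetherian P) (hPreg : Scheme.IsRegular P)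
    (Ch : ∀ X' : Scheme.{0}, (X' ⟶ P) → Set X' → Prop)
    (hChain : ∀ (X' : Scheme.{0}) (σ : X' ⟶ P) (S : Set X'), Ch X' σ S → Chain P Y X' σ S)
    (hStep : ∀ (X' X'' : Scheme.{0}) (σ' : X' ⟶ P) (S' : Set X') (C : X'.IdealSheafData) (τ : X'' ⟶ X'),
      Ch X' σ' S' → IsBlowup τ C → Scheme.IsRegular C.subscheme → Flat (C.subschemeι ≫ σ' ≫ q) →
      σ' '' (C.support : Set X') ⊆ {x : P | ¬ IsGenericPoint x Y} →
      (C.support : Set X') ∩ (σ' ≫ q) ⁻¹' {IsLocalRing.closedPoint O} ⊆ S' →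
      Ch X'' (τ ≫ σ') (closure (τ ⁻¹' (S' \ (C.support : Set X')))))
    (Ruled : Tower.RuledDatum P)
    {F₉ : Scheme.{0}} (Z₉ : Set F₉) (hZ₉ : IsClosed Z₉) {F₁₀ : Scheme.{0}} (υ' : F₁₀ ⟶ F₉)
    (G G' : Scheme.{0}) (γ : G ⟶ F₁₀) (T E K : Set G) (hE : IsClosed E) (Z : Set G) (hZ : IsClosed Z) (υ₂ : G' ⟶ G)
    (hinv : Tower.Inv₃ O k θ P q Y Ch Ruled F₉ Z₉ hZ₉ F₁₀ υ' G γ T E K)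
    (hZET : Z ⊆ E ∩ T) (hfull : TowerFull F₉ F₁₀ υ' Z₉ hZ₉ G γ Z hZ)
    (hυ₂ : IsBlowup υ₂ (vanishingIdeal ⟨Z, hZ⟩))
    -- the assembly's downstairs side facts carried next to `Tower.Inv₂`
    (hKcl : IsClosed K) (hKE : K ⊆ closure (K \ E)) (hKne : K ≠ Set.univ)
    -- THE CENTRE `𝒞 = 𝓔 ⊔ 𝒦₁` at this stage — engine-supplied from `EmbeddedCurveLiftAt`; ₃'s (c6) dropped ((c5) is not needed by the old surface)
    (hCentre : ∀ (X : Scheme.{0}) (σ : X ⟶ P) (S : Set X) (jG : G ⟶ X) (tG : G ⟶ Spec (.of k)) (𝓔 : X.IdealSheafData),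
        Ch X σ S → IsIntegral X → IsLocallyNoetherian X → Scheme.IsRegular X → IsDominant (σ ≫ q) →
        IsPullback jG tG (σ ≫ q) (Spec.map (CommRingCat.ofHom θ)) → jG '' T = S →
        𝓔.comap jG = vanishingIdeal ⟨E, hE⟩ → (∀ z : X, (stalkIdeal 𝓔 z).IsPrincipal) → Scheme.IsRegular 𝓔.subscheme →
        σ '' (𝓔.support : Set X) ⊆ {p : P | ¬ IsGenericPoint p Y} →
        Ruled F₉ Z₉ hZ₉ F₁₀ υ' G γ E X σ jG 𝓔 →
        ∃ 𝒦₁ : X.IdealSheafData,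
          (𝓔 ⊔ 𝒦₁).comap jG = vanishingIdeal ⟨Z, hZ⟩ ∧ Flat ((𝓔 ⊔ 𝒦₁).subschemeι ≫ σ ≫ q) ∧
          Scheme.IsRegular (𝓔 ⊔ 𝒦₁).subscheme ∧ IsEffectiveCartier (𝒦₁.comap 𝓔.subschemeι) ∧
          (∀ x ∈ (𝓔 ⊔ 𝒦₁).support, ∃ c : Fin 2 → X.presheaf.stalk x,
            Ideal.span (Set.range c) = stalkIdeal (𝓔 ⊔ 𝒦₁) x ∧ IsQuasiRegular c))
    -- (N3′) STAND-IN: the transported shadow next to the OLD surface after a Čech round OFF the shadow (owner res-D-pv-051 / res-L1-w45b-stub-2)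
    (hShadowOld : ∀ (X : Scheme.{0}) (σ : X ⟶ P) (S : Set X) (jG : G ⟶ X) (tG : G ⟶ Spec (.of k)) (𝓔 𝒦 𝒦₁ : X.IdealSheafData)
        (X₂ : Scheme.{0}) (τ : X₂ ⟶ X) (j₂ : G' ⟶ X₂) (t₂ : G' ⟶ Spec (.of k)),
        Ch X σ S → IsIntegral X → IsLocallyNoetherian X → Scheme.IsRegular X → IsDominant (σ ≫ q) →
        IsPullback jG tG (σ ≫ q) (Spec.map (CommRingCat.ofHom θ)) → jG '' T = S →
        𝓔.comap jG = vanishingIdeal ⟨E, hE⟩ → (∀ z : X, (stalkIdeal 𝓔 z).IsPrincipal) → Scheme.IsRegular 𝓔.subscheme →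
        (∀ z : X, (stalkIdeal 𝒦 z).IsPrincipal) → ∀ (V : G.Opens), E ⊆ (V : Set G) →
        (𝒦.comap jG).comap V.ι = (vanishingIdeal (⟨closure K, isClosed_closure⟩ : Closeds G)).comap V.ι →
        Flat ((𝓔 ⊔ 𝒦).subschemeι ≫ σ ≫ q) →
        (∀ y : G, jG y ∈ ((𝓔 ⊔ 𝒦).support : Set X) →
          stalkIdeal (vanishingIdeal (⟨E, hE⟩ : Closeds G) ⊔ vanishingIdeal (⟨closure K, isClosed_closure⟩ : Closeds G)) y =
            stalkIdeal (vanishingIdeal (⟨E ∩ closure K, hE.inter isClosed_closure⟩ : Closeds G)) y →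
          IsRegularLocalRing (X.presheaf.stalk (jG y) ⧸ stalkIdeal (𝓔 ⊔ 𝒦) (jG y))) →
        IsEffectiveCartier (𝓔.comap 𝒦.subschemeι) → IsEffectiveCartier (𝒦.comap 𝓔.subschemeι) →
        (𝓔 ⊔ 𝒦₁).comap jG = vanishingIdeal ⟨Z, hZ⟩ → Flat ((𝓔 ⊔ 𝒦₁).subschemeι ≫ σ ≫ q) → Scheme.IsRegular (𝓔 ⊔ 𝒦₁).subscheme →
        IsEffectiveCartier (𝒦₁.comap 𝓔.subschemeι) →
        IsBlowup τ (𝓔 ⊔ 𝒦₁) → IsPullback j₂ t₂ ((τ ≫ σ) ≫ q) (Spec.map (CommRingCat.ofHom θ)) → j₂ ≫ τ = υ₂ ≫ jG →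
        IsClosed K → K ⊆ closure (K \ E) → K ≠ Set.univ → closure (Z \ closure K) = Z →
        ((strictTransformIdeal τ (𝓔 ⊔ 𝒦₁) 𝒦).comap j₂).comap (υ₂ ⁻¹ᵁ V).ι =
            (vanishingIdeal (⟨closure (closure (υ₂ ⁻¹' (K \ Z))), isClosed_closure⟩ : Closeds G')).comap (υ₂ ⁻¹ᵁ V).ι ∧
          Flat ((strictTransformIdeal τ (𝓔 ⊔ 𝒦₁) 𝓔 ⊔ strictTransformIdeal τ (𝓔 ⊔ 𝒦₁) 𝒦).subschemeι ≫ (τ ≫ σ) ≫ q) ∧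
          (∀ (hE' : IsClosed (closure (υ₂ ⁻¹' (E \ Z)))) (y : G'),
            j₂ y ∈ ((strictTransformIdeal τ (𝓔 ⊔ 𝒦₁) 𝓔 ⊔ strictTransformIdeal τ (𝓔 ⊔ 𝒦₁) 𝒦).support : Set X₂) →
            stalkIdeal (vanishingIdeal (⟨closure (υ₂ ⁻¹' (E \ Z)), hE'⟩ : Closeds G') ⊔
              vanishingIdeal (⟨closure (closure (υ₂ ⁻¹' (K \ Z))), isClosed_closure⟩ : Closeds G')) y =
            stalkIdeal (vanishingIdeal (⟨closure (υ₂ ⁻¹' (E \ Z)) ∩ closure (closure (υ₂ ⁻¹' (K \ Z))), hE'.inter isClosed_closure⟩ :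
              Closeds G')) y →
            IsRegularLocalRing (X₂.presheaf.stalk (j₂ y) ⧸
              stalkIdeal (strictTransformIdeal τ (𝓔 ⊔ 𝒦₁) 𝓔 ⊔ strictTransformIdeal τ (𝓔 ⊔ 𝒦₁) 𝒦) (j₂ y))) ∧
          IsEffectiveCartier ((strictTransformIdeal τ (𝓔 ⊔ 𝒦₁) 𝓔).comap (strictTransformIdeal τ (𝓔 ⊔ 𝒦₁) 𝒦).subschemeι) ∧
          IsEffectiveCartier ((strictTransformIdeal τ (𝓔 ⊔ 𝒦₁) 𝒦).comap (strictTransformIdeal τ (𝓔 ⊔ 𝒦₁) 𝓔).subschemeι))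
    -- TRANSPORT of the (generic) datum `Ruled` of the OLD surface along `V(St 𝓔) ≅ V(𝓔)` over `τ` (engine: `Ruled := Tower.FlatExc`) —
    -- shape verbatim from `Tower.inv₃_coneRound_old` (…NatTowerConeRoundOldThree) with `𝒦 ↦ 𝒦₁`
    (hRuled : ∀ (X : Scheme.{0}) (σ : X ⟶ P) (jG : G ⟶ X) (𝓔 𝒦₁ : X.IdealSheafData) (X'' : Scheme.{0}) (τ : X'' ⟶ X)
        (j₂ : G' ⟶ X'') (t₂ : G' ⟶ Spec (.of k)),
        IsBlowup τ (𝓔 ⊔ 𝒦₁) → IsPullback j₂ t₂ ((τ ≫ σ) ≫ q) (Spec.map (CommRingCat.ofHom θ)) → j₂ ≫ τ = υ₂ ≫ jG →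
        (𝓔 ⊔ 𝒦₁).comap jG = vanishingIdeal ⟨Z, hZ⟩ →
        (∃ e : (strictTransformIdeal τ (𝓔 ⊔ 𝒦₁) 𝓔).subscheme ≅ 𝓔.subscheme,
          e.hom ≫ 𝓔.subschemeι = (strictTransformIdeal τ (𝓔 ⊔ 𝒦₁) 𝓔).subschemeι ≫ τ) →
        Ruled F₉ Z₉ hZ₉ F₁₀ υ' G γ E X σ jG 𝓔 →
        Ruled F₉ Z₉ hZ₉ F₁₀ υ' G' (υ₂ ≫ γ) (closure (υ₂ ⁻¹' (E \ Z))) X'' (τ ≫ σ) j₂ (strictTransformIdeal τ (𝓔 ⊔ 𝒦₁) 𝓔))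
    (K' : Set G') (hK' : K' = ∅ ∨ (closure (Z \ closure K) = Z ∧ K' = closure (υ₂ ⁻¹' (K \ Z)))) :
    Tower.Inv₃ O k θ P q Y Ch Ruled F₉ Z₉ hZ₉ F₁₀ υ' G' (υ₂ ≫ γ) (closure (υ₂ ⁻¹' (T \ Z)))
      (closure (υ₂ ⁻¹' (E \ Z))) K' := by
  classical
  obtain ⟨hυ', hZinf, hGint, hTcl, hTirr, hEcl, hTE₀, X, σ, S, jG, tG, hCh, hXint, hXnoeth, hXreg, hdom, hsq, hTS, hexc⟩ := hinv
  haveI := hGint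
  haveI := hXint
  haveI := hXnoeth
  -- the exceptional surface hosts this round, so it is round-ready
  have hZE : Z ⊆ E := fun z hz => (hZET hz).1
  have hZT : Z ⊆ T := fun z hz => (hZET hz).2
  rcases hexc hE with hno | ⟨𝓔, he_i, he_ii, he_iii, he_iv, he_v, hshadow⟩
  · exact absurd hfull (Tower.not_towerFull_of_noRound υ' Z₉ hZ₉ hZinf G γ E hno Z hZ hZE)
  -- (N1) the Čech centre `𝒞 = 𝓔 ⊔ 𝒦₁`
  obtain ⟨𝒦₁, hc1, hc2, hc3, hc4, -⟩ :=
    hCentre X σ S jG tG 𝓔 hCh hXint hXnoeth hXreg hdom hsq hTS he_i he_ii he_iii he_iv he_v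
  -- properness of the stage; the model square
  obtain ⟨-, -, hσ⟩ := chain_isRegular P Y X σ S (hChain _ _ _ hCh) hPnoeth hPreg
  haveI := hσ
  haveI : IsProper (σ ≫ q) := inferInstance
  haveI : IsClosedImmersion (Spec.map (CommRingCat.ofHom θ)) := IsClosedImmersion.spec_of_surjective _ hθ
  haveI hjci : IsClosedImmersion jG := MorphismProperty.IsStableUnderBaseChange.of_isPullback hsq.flip inferInstance
  -- the centre is off the generic point of `Y` (it lies on `V(𝓔)`)
  have hiv : σ '' ((𝓔 ⊔ 𝒦₁).support : Set X) ⊆ {p : P | ¬ IsGenericPoint p Y} := by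
    rintro _ ⟨x, hx, rfl⟩
    exact he_iv ⟨x, Scheme.IdealSheafData.support_antitone le_sup_left hx, rfl⟩
  -- support bookkeeping downstairs
  have hsuppZ : ((vanishingIdeal ⟨Z, hZ⟩ : G.IdealSheafData).support : Set G) = Z := Scheme.IdealSheafData.coe_support_vanishingIdeal _
  have hDT : ((vanishingIdeal ⟨Z, hZ⟩ : G.IdealSheafData).support : Set G) ⊆ T := by rw [hsuppZ]; exact hZT
  have hTZ : ¬ T ⊆ Z := fun h => hTE₀ (h.trans hZE)
  have hTD : ¬ T ⊆ ((vanishingIdeal ⟨Z, hZ⟩ : G.IdealSheafData).support : Set G) := by rw [hsuppZ]; exact hTZ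
  -- blow up the centre and run the model step
  obtain ⟨X₂, τ, hτ⟩ := exists_isBlowup X (𝓔 ⊔ 𝒦₁)
  obtain ⟨hint₂, hnoeth₂, hreg₂, hdom₂, hF₂, hirr, j₂, t₂, hsq₂, hcomm, hCh₂⟩ :=
    modelStep_chain O k θ hθ P q Y hYirr hYcl Ch hChain hStep X σ S hCh hXreg hdom G jG tG hsq T hTS (𝓔 ⊔ 𝒦₁)
      (vanishingIdeal ⟨Z, hZ⟩) hc1 hc3 hc2 hiv hDT hTD X₂ τ hτ G' υ₂ hυ₂
  rw [hsuppZ] at hirr hCh₂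
  haveI := hint₂
  haveI := hnoeth₂
  haveI := hF₂
  haveI : IsProper τ := hτ.isProper
  have hcart : IsPullback j₂ υ₂ τ jG := isPullback_of_model_squares θ hθ (σ ≫ q) τ jG tG hsq j₂ t₂
    (by simpa only [Category.assoc] using hsq₂) υ₂ hcomm
  -- a point of `G'` off the exceptional surface, `T' ⊄ E''`, the centre is non-zero
  obtain ⟨t, htT, htE⟩ := Set.not_subset.mp hTE₀
  have htZ : t ∉ Z := fun h => htE (hZE h)
  obtain ⟨t', ht'⟩ := hυ₂.exists_preimage_of_not_mem_support (z := t) (by rw [hsuppZ]; exact htZ)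
  have hCne : 𝓔 ⊔ 𝒦₁ ≠ ⊥ := by
    rintro hbot
    obtain ⟨u, hu, hKu⟩ := hτ.isEffectiveCartier.exists_stalkIdeal_eq_span (j₂ t')
    rw [hbot, Scheme.IdealSheafData.comap_bot, stalkIdeal_bot, eq_comm, Ideal.span_singleton_eq_bot] at hKu
    rw [hKu] at hu
    exact zero_notMem_nonZeroDivisors hu
  have hTE'' : ¬ closure (υ₂ ⁻¹' (T \ Z)) ⊆ closure (υ₂ ⁻¹' (E \ Z)) := by
    intro h
    have h1 : t' ∈ closure (υ₂ ⁻¹' (T \ Z)) := subset_closure (show υ₂ t' ∈ T \ Z by rw [ht']; exact ⟨htT, htZ⟩)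
    have h2 : t' ∈ υ₂ ⁻¹' E :=
      (closure_minimal (Set.preimage_mono fun x hx => hx.1) (hE.preimage υ₂.continuous)) (h h1)
    rw [Set.mem_preimage, ht'] at h2
    exact htE h2
  -- the density `E ⊆ closure (E ∖ Z)` (stub-2's engine, p564222) and the transported old surface `𝓔'' := St_𝒞 𝓔`
  have hEZ : E ⊆ closure (E \ Z) :=
    subset_closure_diff_of_flat_of_isEffectiveCartier θ hθ q σ jG tG hsq 𝓔 𝒦₁ hE hZ he_i hc1 hc2 hc4
  have hEc : ((⟨E, hE⟩ : Closeds G) : Set G) ⊆ closure (((⟨E, hE⟩ : Closeds G) : Set G) \ (⟨Z, hZ⟩ : Closeds G)) := hEZ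
  have ho1 : (strictTransformIdeal τ (𝓔 ⊔ 𝒦₁) 𝓔).comap j₂ =
      vanishingIdeal (⟨closure (υ₂ ⁻¹' (E \ Z)), isClosed_closure⟩ : Closeds G') :=
    coneRound_exceptional_comap 𝓔 𝒦₁ hc4 hτ hcart ⟨E, hE⟩ ⟨Z, hZ⟩ he_i hυ₂ hEc
  have ho2 : ∀ z : X₂, (stalkIdeal (strictTransformIdeal τ (𝓔 ⊔ 𝒦₁) 𝓔) z).IsPrincipal := fun z =>
    isPrincipal_stalkIdeal_strictTransformIdeal hXreg hc3 hτ hCne 𝓔 he_ii z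
  obtain ⟨e𝓔, he𝓔⟩ := exists_iso_subscheme_strictTransformIdeal_exceptional 𝓔 𝒦₁ hc4 hτ
  have ho3 : Scheme.IsRegular (strictTransformIdeal τ (𝓔 ⊔ 𝒦₁) 𝓔).subscheme :=
    Scheme.IsRegular.of_isOpenImmersion e𝓔.hom he_iii
  have ho4 : (τ ≫ σ) '' ((strictTransformIdeal τ (𝓔 ⊔ 𝒦₁) 𝓔).support : Set X₂) ⊆ {p : P | ¬ IsGenericPoint p Y} := by
    rintro _ ⟨z, hz, rfl⟩
    have hz' : z ∈ ((𝓔.comap τ).support : Set X₂) :=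
      Scheme.IdealSheafData.support_antitone (comap_le_strictTransformIdeal τ (𝓔 ⊔ 𝒦₁) 𝓔) hz
    rw [Scheme.IdealSheafData.support_comap] at hz'
    exact he_iv ⟨τ z, hz', rfl⟩
  -- (e-v) the (generic) exceptional-surface datum is TRANSPORTED along `V(St 𝓔) ≅ V(𝓔)` (`hRuled`)
  have ho5 : Ruled F₉ Z₉ hZ₉ F₁₀ υ' G' (υ₂ ≫ γ) (closure (υ₂ ⁻¹' (E \ Z))) X₂ (τ ≫ σ) j₂ (strictTransformIdeal τ (𝓔 ⊔ 𝒦₁) 𝓔) :=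
    hRuled X σ jG 𝓔 𝒦₁ X₂ τ j₂ t₂ hτ hsq₂ hcomm hc1 ⟨e𝓔, he𝓔⟩ he_v
  -- (k-i) for the transported shadow is generic
  have hk1 : ∀ (𝒦 : X.IdealSheafData), (∀ z : X, (stalkIdeal 𝒦 z).IsPrincipal) →
      ∀ z : X₂, (stalkIdeal (strictTransformIdeal τ (𝓔 ⊔ 𝒦₁) 𝒦) z).IsPrincipal := fun 𝒦 h𝒦 z =>
    isPrincipal_stalkIdeal_strictTransformIdeal hXreg hc3 hτ hCne 𝒦 h𝒦 z
  -- assemble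
  refine ⟨hυ', hZinf, hF₂, isClosed_closure, hirr, isClosed_closure, hTE'', X₂, τ ≫ σ, _, j₂, t₂, hCh₂, hint₂, hnoeth₂,
    hreg₂, hdom₂, hsq₂, rfl, fun hE' => Or.inr ⟨strictTransformIdeal τ (𝓔 ⊔ 𝒦₁) 𝓔, ho1, ho2, ho3, ho4, ho5, ?_⟩⟩
  rcases hK' with hK' | ⟨hoff, hK'⟩
  · exact Or.inl hK'
  · subst hK'
    rcases hshadow with hK0 | ⟨𝒦, hk_i, ⟨V, hEV, hk_ii⟩, hk_iii, hk_iv, hk_v, hk_vi⟩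
    · left
      subst hK0
      simp only [Set.empty_sdiff, Set.preimage_empty, closure_empty]
    · right
      obtain ⟨hs2, hs3, hs4, hs5, hs6⟩ := hShadowOld X σ S jG tG 𝓔 𝒦 𝒦₁ X₂ τ j₂ t₂ hCh hXint hXnoeth hXreg hdom hsq hTS he_i he_ii he_iii
        hk_i V hEV hk_ii hk_iii hk_iv hk_v hk_vi hc1 hc2 hc3 hc4 hτ hsq₂ hcomm hKcl hKE hKne hoff
      exact ⟨_, hk1 𝒦 hk_i, ⟨υ₂ ⁻¹ᵁ V, (closure_minimal (Set.preimage_mono fun x hx => hx.1) (hE.preimage υ₂.continuous)).trans (Set.preimage_mono hEV), hs2⟩, hs3, hs4 hE', hs5, hs6⟩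

end Summit.ResolutionOfSingularities.ResolutionOfSingularities.Cruxes.EquisingularLiftNat.Sections

end
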